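import Mathlib
import HarnessLib
import HarnessLib.Audit
import Summits.HodgeConjecture.Statement
import Literature.AlgebraicGeometry.Motives.KugaSatakeCorrespondenceByRank
import Literature.AlgebraicGeometry.Motives.PeriodRealizationClassical
import HarnessLib.Audit.Status.Attr

/-!
Route: KulikovCuspKugaSatake

# Route KulikovCuspKugaSatake — Kuga–Satake correspondence algebraic in Witt index 2 by NL-induction
on rk T anchored at the type II Kulikov cusp

It suffices to show X = KugaSatakeWittTwo ∧ SectorComplement. KugaSatakeWittTwo (the SECTOR, = "X(r)
for every r"): for every
classical Betti–Hodge datum B and every complex projective K3 surface S whose rational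
transcendental lattice T(S)_ℚ has rank r and
contains an isotropic plane (Witt index 2; automatic for every K3 with ρ(S) ≤ 15), the
lattice-polarized Kuga–Satake correspondence of
(S, NS(S)_ℚ) is algebraic (`IsKSCorrespondenceAlgebraic`, operator form). It is proved by induction
on r: base r ≤ 6 (support RankSixBase =
Floccari2026 Thm 5.11 + a lattice embedding), anchor X(< r) ⇒ KSC on every Noether–Lefschetz divisor
of M_T (support NLAnchor, Clifford
algebra + Lefschetz for End of abelian varieties), and the deciding crux CuspStep: anchored ⇒ X(r)
for r ≥ 7, by lifting the flat limit of
the anchored cycle off the NL trace at the TYPE II KULIKOV CUSP of M_T (log-semiregular lifting on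
the Kulikov × Mumford boundary family)
and spreading. SectorComplement (declared RESIDUAL, summit-grade by declaration, the device of route
KugaSatakeSaturation): the Hodge
conjecture off this sector. Sketch realised: markdown-wave sketch kulikov-cusp-kuga-satake
(run/shared/lean/mwave/sketch/HodgeConjecture/kulikov-cusp-kuga-satake/SKETCH.md, reader PASS
4/4/3/2; no idea card of that slug exists in the index).
Lean: `(∀ (B : Literature.AlgebraicGeometry.Motives.BettiHodgeData ℂ), B.IsClassical → ∀ r : ℕ,
B.IsKSCAlgebraicAtRank r) ∧ ((∀ (B : Literature.AlgebraicGeometry.Motives.BettiHodgeData ℂ),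
B.IsClassical → ∀ r : ℕ, B.IsKSCAlgebraicAtRank r) → _root_.HodgeConjecture)`

## Assembly
Pure logic: strong induction on r = rk T(S)_ℚ. For r < 7 RankSixBase gives X(r); for r ≥ 7 the
induction hypothesis X(< r) feeds NLAnchor,
whose output is the hypothesis of CuspStep, which returns X(r); hence KugaSatakeWittTwo;
SectorComplement then yields the Hodge conjecture.
The deciding theorem (rev 1, 2026-08-17) is `closes (hBase : RankSixBase) (hNL : NLAnchor) (hCusp :
CuspStep) (hC : SectorComplement) :
_root_.HodgeConjecture`: it PROVES the Assembly item inline (`have hA : Assembly := by intro hBase'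
hNL' hCusp' hC'; refine hC' fun B hB r ↦ ?_;
induction r using Nat.strong_induction_on with | _ r ih => rcases Nat.lt_or_ge r 7 with hr | hr; ·
exact hBase' B hB r (by omega);
· exact hCusp' B hB r hr (hNL' B hB r ih)`) and applies it, so `Assembly` stays in the cone of
`closes` without being one of its hypotheses —
the load-bearing binders are exactly the two supports, the deciding crux CuspStep and the declared
residual SectorComplement (gate native
check: ok, conclusion HodgeConjecture, axioms propext / Classical.choice / Quot.sound). Residual:
SectorComplement.

Rationale: WHY THIS LINE. Every printed case of the Kuga–Satake Hodge conjecture is INTERIOR and by transfer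
through special geometry (Paranjape, Schlickewei,
Floccari2026 via hyper-Kähler varieties of generalized Kummer type, rank ≤ 6 in Witt index 2:
arXiv:2501.02315 Thm 5.11, "widely open"
beyond, p. 7); nobody uses the BOUNDARY of the lattice-polarized period space M_T to produce the
cycle, although the limit Kuga–Satake
structure and semistable KS models at type II cusps exist (arXiv:1710.02102 Thm 1.1/1.2, no
cycle-theoretic consequence drawn). The
mechanism imported from deformation theory is Bloch–Buchweitz–Flenner semiregular lifting
(BuchweitzFlenner2003 Thm 5.1, smooth special
fibre only) in a LOG form on the Kulikov type II model × Mumford model (arXiv:2101.12186 §3,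
arXiv:2310.07949 Cor 1.6.7 for unobstructed
log Calabi–Yau directions), applied to an anchor object that is FREE: Noether–Lefschetz divisors
M_{T′} ⊂ M_T pass through the cusp and
carry KSC by the induction hypothesis (the Clifford identity C(T) = C(T′) ⊕ C(T′)v makes
κ_T|_{M_{T′}} = κ_{T′} ⊕ κ_{T′} up to an algebraic
Hodge endomorphism), so the representative to deform is a flat limit of algebraic cycles with
non-zero transcendental content — exactly
what the retired route TropicalCuspLift lacked at its dead step (factorwise anchor, K-balance
obstruction). From Hodge theory we import the
lattice-polarized period spaces and their NL divisors (CattaniDeligneKaplan1995 used positively),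
from K3 geometry Kulikov–Persson–Pinkham
models, from arithmetic geometry Mumford/Faltings–Chai degenerations of the KS abelian scheme; no
spectral or probabilistic reformulation
(none touches codimension-2 classes on S × KS(S)). Negatives index (3 entries: Milnor-K symbol lift,
Fermat derived-Torelli exhaustion,
E-line connectivity) is disjoint from this line.

RANKED CRUXES. #0 KugaSatakeWittTwo (target) — for every classical Betti–Hodge datum B and every r,
X(r): the NS-polarized Kuga–Satake correspondence of every complex projective K3 surface with rk
T(S)_ℚ = r and an isotropic rational plane in T(S)_ℚ is algebraic (Kuga–Satake Hodge conjecture in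
Witt index 2; card item K0). (why it might fail: it is an open conjecture beyond rank 6
(Floccari2026 p.7); a K3 of Picard rank ≤ 15 whose KS class is not algebraic refutes it and, κ being
motivated (Andre1996), standard conjecture B with it.) [Floccari2026, Huybrechts2016K3,
arXiv:math/9903146, arXiv:1710.02102]
#2 CuspStep (crux) — for every classical B and every r ≥ 7: if the L-polarized KS correspondence is
algebraic for every (S, L ≤ NS(S)_ℚ) with rk L^⊥ = r, rk T(S) < r and Witt index 2 (the NL-anchored
hypothesis), then X(r). Intended proof (card K1+K2+K3+S1+S2+S5): flat limit of the anchored cycle at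
the type II Kulikov cusp of the NL divisor, log-semiregular lift one direction off the trace on the
Kulikov × Mumford boundary family, Zariski-thick algebraicity locus, spread by
countable-closed-union + Baire. [difficulty: XL] (why it might fail: the flat-limit anchor may be
rigid off the NL trace (obstructions invisible to H_lim: ker sp / coker directions); no
log-semiregularity theorem for perfect complexes on an snc fibre is in print; an extra
so(T_lim)-invariant limit class at some r ≥ 8 breaks the criterion.) [arXiv:1710.02102,
arXiv:2101.12186, arXiv:2310.07949, BuchweitzFlenner2003, arXiv:math/9912245, Floccari2026]
#3 SectorComplement (crux) — RESIDUAL (declared, not claimed; D-0027 §2.2, verbatim the device of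
KugaSatakeSaturation / NikulinTwinTransport): the Kuga–Satake sector statement implies the Hodge
conjecture — content = HC off the sector (abelian type in general, Weil classes, hypersurfaces);
implied by HC, used toward HC, never provable alone. [deps: KugaSatakeWittTwo] [difficulty:
open-problem] (why it might fail: it is summit-grade by declaration: equivalent to the Hodge
conjecture given the sector; it fails exactly if HC fails off the K3 × Kuga–Satake sector (e.g. a
non-algebraic Weil class on an abelian fourfold).) [Voisin2002, Andre1996, Huybrechts2016K3]
#9 RankSixBase (support) — base of the induction: X(r) for r ≤ 6 — Floccari2026 Thm 5.11 (KSC for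
T(S)_ℚ ↪ U³ ⊕ ⟨−m⟩) plus the lattice lemma that every Witt-index-2 form of rank ≤ 6 embeds so (r =
5: U²⊕⟨−δ⟩; r = 6: U²⊕⟨−α,−β⟩ ↪ U³⊕⟨−β⟩ via ⟨−α, α⟩ ≅ U), transported to the operator form over a
classical B. [difficulty: L] [Floccari2026, arXiv:2501.02315, Huybrechts2016K3]
#9 NLAnchor (support) — the Noether–Lefschetz anchor (card S3/O1): if X(r′) holds for all r′ < r
then the L-polarized KS correspondence is algebraic whenever rk L^⊥ = r > rk T(S): with T′ := T(S)_ℚ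
⊊ L^⊥ =: T, C(T) ≅ C(T′)^{⊕2^d} as left C(T′)-modules, κ_T = diag(κ_{T′}) up to right
multiplications, which commute with the even Clifford algebra ⊇ MT and are therefore algebraic Hodge
endomorphisms of the KS abelian variety (Lefschetz (1,1) + Poincaré reducibility); composition of
correspondences. [difficulty: XL] [Huybrechts2016K3, arXiv:math/9903146, Varesco2025]

TWO-LAYER PLAN. CuspStep ⇐ CuspEngine → Spread → CuspStep once the boundary-family interface
(definition request TypeIIBoundaryFamily) lands: CuspEngine =
"anchored ⇒ the KSC locus of every lattice-polarized moduli chart through S is Zariski-thick" (the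
type II engine K1+K2+K3 of the card),
Spread = "Zariski-thick KSC locus ⇒ all of the chart" (countable union of closed algebraic subsets +
Baire; shared in substance with
TateCuspKLift's spreading support). The registered birth skeleton Cruxes/CuspStep/Lines/birth.lean
already has this shape
(stub_moduliChart, stub_cuspEngine, stub_spread, stub_transport; CuspStep_of kernel-checked).

KILL CRITERIA. Refutation of CuspStep at any single r ≥ 7 (a classical B, a K3 with rk T = r, Witt
index 2, anchored hypothesis true, KSC false) closes
the route `refuted:CuspStep` — and refutes the Kuga–Satake Hodge conjecture, hence standard
conjecture B (informative either way). A proof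
that the flat-limit anchor is obstructed off the NL trace for GENERIC boundary points at r = 7 (the
calibration T₇ = U² ⊕ A₂(−1) ⊕ ⟨−2⟩-type
lattices) kills the mechanism and forces a pivot to the interior NL-closure variant (card
orientation-class-discriminant-cover) or
retirement. KugaSatakeWittTwo proved elsewhere (any printed KSHC in Witt index 2) moots the route
happily; RankSixBase or NLAnchor refuted
AS TYPED means the operator-form currency is misstated (repair: restate over the corrected
predicate), not that the line is dead.

NOT DECOMPOSED YET. The interior of CuspStep's engine — boundary family model (Kulikov II × Mumford,
multi-parameter), log Atiyah class / log
semiregularity map for perfect complexes on an snc fibre, limit mixed Hodge structure bookkeeping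
(so(T_lim)-invariants), relative
Chow closedness of effective loci — is deliberately ONE stub (stub_cuspEngine) until the definition
requests below land; these are
layer-2 children for tenure. The Clifford-algebra lemmas of NLAnchor (left multiplication by an
NS-orthogonal vector preserves F¹;
parity operator is a Hodge endomorphism) are prover-attached helpers, not items.

CHEAPEST FALSIFIER. Lookup, run by this seat: is X(6) really in print for EVERY rank-6 Witt-index-2
lattice (else the induction has no base)? Floccari2026
Thm 5.11 read ([corpus:paper-arxiv-2501.02315 p.18]) + the embedding U²⊕⟨−α,−β⟩ ↪ U³⊕⟨−β⟩: yes. Next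
cheapest (a refuter, one kit job):
the generic limit-Hodge count (so(T_lim)-invariants in H⁴_lim of S × A at a type II cusp) at r = 8 —
an extra invariant class breaks the
criterion inside stub_cuspEngine as intended and forces a re-typing of the admissible span.

NUMBERS. Induction base r ≤ 6 (Floccari2026 Thm 5.11); range of the sector 4 ≤ r ≤ 21 with Witt
index 2 (every projective K3 with ρ ≤ 15, since
rk T ≥ 7 > 2·2 + 2 forces an isotropic plane by Meyer); first open rung r = 7 (T ≅ U² ⊕ N, N
negative definite of rank 3); KS abelian
variety of dimension 2^{r−1} (full Clifford model); type II boundary components of M_T ↔ isotropic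
planes I ⊂ T.

DEFINITION REQUESTS. - TypeIIBoundaryFamily (topic
Summits/HodgeConjecture/HodgeConjecture/Theorems): interface = flat projective family Y → U of
d-semistable
  K-trivial snc varieties over an étale neighbourhood U of a general point of a type II boundary
component of the toroidal compactification
  of M_T, restricting on transversal arcs to (Kulikov type II model) × (Mumford model), with
specialization maps H⁴(fibre) → H⁴_lim and the
  transcendental-content projection; plus a separate CONSTRUCTION statement (existence near general
boundary points; arXiv:2101.12186 Thm 3.13,
  Faltings–Chai III, arXiv:1710.02102 §4).
- PerfectComplexOnSNC with Chern character and derived restriction (topic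
Literature/AlgebraicGeometry/Deformation): perfect complexes on an
  snc ℂ-scheme, ch into singular cohomology of the analytification, Li^* to components; obstruction
class in Ext².
- LogSemiregularityMap (topic Literature/AlgebraicGeometry/HodgeTheory): σ^log = Σ tr(− ∘
(At^log)^q)/q! : Ext²(E,E) → ⊕ H^{q+2}(Ω^q_{Y₀†/0†}),
  extending the tree's abstract `SemiregularityMap`.
- LimitMixedHodgeStructure / specialization map for a semistable degeneration (topic
Literature/AlgebraicGeometry/HodgeTheory), on top of
  `Motives.LogSmoothDegeneration`.
- cite facts wanted: "fact: Floccari2026 Thm 5.11 with Lemma 5.4" (doi:10.2140/gt.2026.30.1129);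
"fact: Varesco2025 Thm 1 + Cor 2.23"
  (consumer side, not load-bearing).

Novelty: Searches (2026-08-17): lit search --hybrid "Kuga-Satake Hodge conjecture K3 degeneration" (8 hits,
Floccari/van Geemen/Schreieder–Soldatenkov,
none boundary-cycle); lit search "semiregularity map degeneration normal crossings"
(Buchweitz–Flenner, Bloch, Pridham, BLM — smooth fibres only:
[corpus:paper:arxiv-math_9912245 p.25], [corpus:paper:arxiv-1612.00754 p.5],
[corpus:paper:arxiv-2009.01651 p.3], [corpus:paper:arxiv-2509.23403 p.18]);
lit galaxy search "Kuga-Satake|Kulikov model|semiregularity" --star all (hits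
[galaxy:panama:193385197469760] Fields Inst. Comm. 67,
[galaxy:panama:346861558824997] Kerr–Pearlstein, [galaxy:panama:372751621685301] Deformation Spaces,
[galaxy:panama:350460741419060]
Green–Murre–Voisin — none lifts a codimension-2 cycle off a Kulikov/Mumford degeneration); lit
search "lattice polarized K3 Kuga-Satake family
Noether-Lefschetz" ([corpus:book:laza2013-arithmetic-geometry-k3-surfaces-calabi-yau-threefolds
p.535, 541, 544]); lean search
'KugaSatake|IsK3Surface|transcendental' (tree: KugaSatakeHodgeConjectureFor single-surface Gysin
form, KugaSatakeFull, PeriodRealizationClassical;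
no rank-graded or lattice-polarized KSC predicate before p169390/p170000); ledger negatives
--problem HodgeConjecture (3, unrelated); ledger
route ls (62 theses of the sub; K3/boundary ones read: KugaSatakeSaturation, TropicalCuspLift
(retired), TateCuspKLift, NikulinTwinTransport,
ELineTransport, BoundaryReadout, NoetherLefschetzOneUp, PadicSemiregularLift).
Nearest prior  [refs: 1710.02102, 2501.02315, paper:arxiv-math_9912245, paper:arxiv-1612.00754, paper:arxiv-2009.01651, paper:arxiv-2509.23403, book:laza2013-arithmetic-geometry-k3-surfaces-calabi-yau-threefolds, paper:arxiv-2501.02315, book:huybrechtsnd-lectures-k3-surfaces, Floccari2026, BuchweitzFlenner2003]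

Barriers (technique_class: kulikov-cusp, log-semiregular, noether-lefschetz-locus): - technique_class: kulikov-cusp (type II degeneration-to-boundary), log-semiregular lift of cycles,
noether-lefschetz-locus induction on rk T, hodge-locus spreading, kuga-satake
- Literature.Barriers.HodgeConjecture.CattaniDeligneKaplan1995_hodgeLocus_algebraicFor: OUTSIDE its
class (a refutation-side barrier: no non-algebraic Hodge locus can refute HC) and used positively —
M_T, its NL divisors and the KSC locus of a lattice-polarized chart are Hodge-locus-type algebraic
sets (stub_spread of Cruxes/CuspStep/Lines/birth.lean consumes exactly this shape); never
contradicted. This is the one catalogued barrier in the route's technique class (T4 placement);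
every other entry below is outside the class and listed for the record.
- Literature.Barriers.HodgeConjecture.Clemens1983_griffithsGroup_infiniteRank: outside its class —
one perfect complex is deformed, no cycle group / Abel–Jacobi invariant is parametrised.
- Literature.Barriers.HodgeConjecture.Voisin2003_generalHypersurface_noIntegralClassInF: outside its
class — no normal function, no Jacobi inversion; the boundary is used for its central FIBRE, not for
singularities of normal functions.
- Literature.Barriers.HodgeConjecture.Voisin2002_weilTorus_hodgeClassWithoutSubvarieties: evaded by
projectivity at every step (algebraic toroidal compactification, relative Chow, Grothendieck
existence for projective f); coherent sheaves / perfect complexes are used only on projective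
fibres.
- Literature.Barriers.HodgeConjecture.Zucker1

sub-problem: HodgeConjecture · status: draft · opened planner-type-75571b34d7-0 2026-08-17T16:26:14Z · rev 4 · ledger route-HodgeConjecture-KulikovCuspKugaSatake
GENERATED by the gate from the ledger (D-0016/17). Provers cite these decls: `theorem foo : Summit.HodgeConjecture.HodgeConjecture.Theses.KulikovCuspKugaSatake.<Decl> := …` in Summits/HodgeConjecture/HodgeConjecture/Theorems/<Name>.lean.
-/

namespace Summit.HodgeConjecture.HodgeConjecture.Theses.KulikovCuspKugaSatake

open scoped BigOperators Topology Manifold Classical MeasureTheory ProbabilityTheory Matrix InnerProductSpace ComplexConjugate ContinuousMap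
open Filter Set Function TopologicalSpace MeasureTheory

attribute [summit_statement] _root_.HodgeConjecture

/-- item stmt-HodgeConjecture-18397 · target · rank 0 · open · by planner
why it might fail: it is an open conjecture beyond rank 6 (Floccari2026 p.7); a K3 of Picard rank ≤ 15 whose KS class is not algebraic refutes it and, κ being motivated (Andre1996), standard conjecture B with it.
sources: Floccari2026, Huybrechts2016K3, arXiv:math/9903146, arXiv:1710.02102
[target] for every classical Betti–Hodge datum B and every r, X(r): the NS-polarized Kuga–Satake
correspondence of every complex projective K3 surface with rk T(S)_ℚ = r and an isotropic rational
plane in T(S)_ℚ is algebraic (Kuga–Satake Hodge conjecture in Witt index 2; card item K0). -/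
@[route_item "route-HodgeConjecture-KulikovCuspKugaSatake"]
def KugaSatakeWittTwo : Prop :=
  ∀ (B : Literature.AlgebraicGeometry.Motives.BettiHodgeData ℂ), B.IsClassical → ∀ r : ℕ, B.IsKSCAlgebraicAtRank r

/-- item stmt-HodgeConjecture-18398 · crux · rank 2 · open · by planner
why it might fail: the flat-limit anchor may be rigid off the NL trace (obstructions invisible to H_lim: ker sp / coker directions); no log-semiregularity theorem for perfect complexes on an snc fibre is in print; an extra so(T_lim)-invariant limit class at some r ≥ 8 breaks the criterion.
sources: arXiv:1710.02102, arXiv:2101.12186, arXiv:2310.07949, BuchweitzFlenner2003, arXiv:math/9912245, Floccari2026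
[crux] for every classical B and every r ≥ 7: if the L-polarized KS correspondence is algebraic for
every (S, L ≤ NS(S)_ℚ) with rk L^⊥ = r, rk T(S) < r and Witt index 2 (the NL-anchored hypothesis),
then X(r). Intended proof (card K1+K2+K3+S1+S2+S5): flat limit of the anchored cycle at the type II
Kulikov cusp of the NL divisor, log-semiregular lift one direction off the trace on the Kulikov ×
Mumford boundary family, Zariski-thick algebraicity locus, spread by countable-closed-union + Baire.
[difficulty: XL] -/
@[route_item "route-HodgeConjecture-KulikovCuspKugaSatake", crux]
def CuspStep : Prop :=
  ∀ (B : Literature.AlgebraicGeometry.Motives.BettiHodgeData ℂ), B.IsClassical → ∀ r : ℕ, 7 ≤ r → B.IsKSCAnchoredAtRank r → B.IsKSCAlgebraicAtRank r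

/-- item stmt-HodgeConjecture-18399 · crux · rank 3 · open · by planner
why it might fail: it is summit-grade by declaration: equivalent to the Hodge conjecture given the sector; it fails exactly if HC fails off the K3 × Kuga–Satake sector (e.g. a non-algebraic Weil class on an abelian fourfold).
sources: Voisin2002, Andre1996, Huybrechts2016K3
[crux] RESIDUAL (declared, not claimed; D-0027 §2.2, verbatim the device of KugaSatakeSaturation /
NikulinTwinTransport): the Kuga–Satake sector statement implies the Hodge conjecture — content = HC
off the sector (abelian type in general, Weil classes, hypersurfaces); implied by HC, used toward
HC, never provable alone. [deps: KugaSatakeWittTwo] [difficulty: open-problem] -/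
@[route_item "route-HodgeConjecture-KulikovCuspKugaSatake", crux]
def SectorComplement : Prop :=
  KugaSatakeWittTwo → _root_.HodgeConjecture

/-- item stmt-HodgeConjecture-18400 · support · rank 9 · open · by planner
sources: Floccari2026, arXiv:2501.02315, Huybrechts2016K3
[support] base of the induction: X(r) for r ≤ 6 — Floccari2026 Thm 5.11 (KSC for T(S)_ℚ ↪ U³ ⊕ ⟨−m⟩)
plus the lattice lemma that every Witt-index-2 form of rank ≤ 6 embeds so (r = 5: U²⊕⟨−δ⟩; r = 6:
U²⊕⟨−α,−β⟩ ↪ U³⊕⟨−β⟩ via ⟨−α, α⟩ ≅ U), transported to the operator form over a classical B.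
[difficulty: L] -/
@[route_item "route-HodgeConjecture-KulikovCuspKugaSatake", crux]
def RankSixBase : Prop :=
  ∀ (B : Literature.AlgebraicGeometry.Motives.BettiHodgeData ℂ), B.IsClassical → ∀ r : ℕ, r ≤ 6 → B.IsKSCAlgebraicAtRank r

/-- item stmt-HodgeConjecture-18401 · support · rank 9 · open · by planner
sources: Huybrechts2016K3, arXiv:math/9903146, Varesco2025
[support] the Noether–Lefschetz anchor (card S3/O1): if X(r′) holds for all r′ < r then the
L-polarized KS correspondence is algebraic whenever rk L^⊥ = r > rk T(S): with T′ := T(S)_ℚ ⊊ L^⊥ =: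
T, C(T) ≅ C(T′)^{⊕2^d} as left C(T′)-modules, κ_T = diag(κ_{T′}) up to right multiplications, which
commute with the even Clifford algebra ⊇ MT and are therefore algebraic Hodge endomorphisms of the
KS abelian variety (Lefschetz (1,1) + Poincaré reducibility); composition of correspondences.
[difficulty: XL] -/
@[route_item "route-HodgeConjecture-KulikovCuspKugaSatake", crux]
def NLAnchor : Prop :=
  ∀ (B : Literature.AlgebraicGeometry.Motives.BettiHodgeData ℂ), B.IsClassical → ∀ r : ℕ, (∀ r' : ℕ, r' < r → B.IsKSCAlgebraicAtRank r') → B.IsKSCAnchoredAtRank r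

/-- item stmt-HodgeConjecture-18402 · assembly · rank 1 · closed · proved by Summit.HodgeConjecture.HodgeConjecture.Theorems.kulikovCuspKugaSatake_assembly_proof @ 3390f67833dc (prover) · by planner
sources: Floccari2026, arXiv:1710.02102
[assembly] RankSixBase → NLAnchor → CuspStep → SectorComplement → the Hodge conjecture (strong
induction on r = rk T(S)_ℚ; provable now, proof text in § Assembly). -/
@[route_item "route-HodgeConjecture-KulikovCuspKugaSatake"]
def Assembly : Prop :=
  RankSixBase → NLAnchor → CuspStep → SectorComplement → _root_.HodgeConjecture

/-! D-0027 §2.1 — DECIDING THEOREM (planner-authored via `route open/edit --closes-file`; by planner-rbadge-HodgeConjecture-KulikovCuspKuga-e1cff1dd-0 2026-08-17T17:34:37Z):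
its hypotheses are this route's items and its conclusion the sub-problem Statement (glue_lint), and it elaborates with this file. -/

@[closes "route-HodgeConjecture-KulikovCuspKugaSatake"] theorem closes (hBase : RankSixBase) (hNL : NLAnchor) (hCusp : CuspStep) (hC : SectorComplement) :
    _root_.HodgeConjecture :=
  -- The `Assembly` item is pure logic (strong induction on r = rk T(S)_ℚ): it is PROVED here and applied, so it
  -- stays in the cone of `closes` without being a hypothesis of it (D-0027 §2.1); the load-bearing binders are
  -- exactly the two supports, the deciding crux `CuspStep` and the declared residual `SectorComplement`.
  have hA : Assembly := by
    intro hBase' hNL' hCusp' hC'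
    refine hC' fun B hB r => ?_
    induction r using Nat.strong_induction_on with
    | _ r ih =>
      rcases Nat.lt_or_ge r 7 with hr | hr
      · exact hBase' B hB r (by omega)
      · exact hCusp' B hB r hr (hNL' B hB r ih)
  hA hBase hNL hCusp hC

end Summit.HodgeConjecture.HodgeConjecture.Theses.KulikovCuspKugaSatake
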